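import Literature.Probability.RandomPlanarGeometry.HexParafermion
import Literature.Probability.RandomPlanarGeometry.HexSAW
import Literature.Probability.RandomPlanarGeometry.CurveTortuosity
import Literature.Probability.LatticeModels.LatticeInterface

/-!
# Objects of the line `reversal-virgin-disc` for the crux `HexTight` (stmt-CriticalPhenomena-5423)

Lead prover `prover-line-stmt-CriticalPhenomena-5423-0` (crux protocol; skeleton
`Summits/CriticalPhenomena/SAWScalingLimit/Cruxes/HexTight/Lines/reversal-virgin-disc.lean`, planner
generations 1–2). This file only DEFINES the finite combinatorial objects the line's stubs speak about —
`x_c`-weighted self-avoiding arcs of the hexagonal lattice between two mid-edges, filtered by an edge set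
`H`, and the "virgin disc" configuration — so that the stub files under `Theorems/` and the lead's
skeleton share ONE copy of them. No statement of the line is asserted or even named here (the six stub
statements live, inlined over these objects, in the skeleton and in the stub files).

* `IsHArc H γ` — the arc `γ : HexMidEdgeSAW Λ w w'` uses only edges of `H` (in applications
  `H = hexDomainGraph Ω δ`, the graph carrying `hexSAWLaw`; inside a virgin disc `H ⊇ ℍ`);
* `arcCurve γ` — the arc as the polyline `mid(w), c(v₁), …, c(vₙ), mid(w')` (lattice units);
* `arcMass H Λ w w'` — `Z^H_Λ(w → w') = Σ_{H-arcs} x_c^{ℓ}`; `diveMass … z₀ r` — the part visiting the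
  closed disc `B̄(z₀, r)`; `travMass … k z₀ r R` — the part whose polyline traverses the shell `D(z₀; r, R)`
  by `k` separate segments (`Curve.HasTraversals`, Aizenman–Burchard's event);
* `Straddles Λ z₀ N w` — `w = {u, c}` is a DOOR on the circle of radius `N`: `c ∈ Λ` in the closed disc,
  `u ∉ Λ` strictly outside, `u ∼ c` in `ℍ`;
* `IsVirgin H Λ z₀ N` — the open lattice disc of radius `N` lies in `Λ` and `H` contains every `ℍ`-edge
  between cells of the closed `(N+1)`-disc; NOTHING is assumed outside.

Sources: H. Duminil-Copin, S. Smirnov, Ann. of Math. 175 (2012) (arXiv:1007.0575) §1–2 (walks between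
mid-edges, weight `x_c^ℓ`); M. Aizenman, A. Burchard, Duke Math. J. 99 (1999) §1.b (separate traversals).
Deliberately NOT here: the line's statements (`DiveRecursion`, `OneScaleDive`, …) and any theorem beyond the one
termwise API inequality `diveMass_le_arcMass` (the registered sub-goal this file carries).
-/

noncomputable section

open scoped BigOperators Classical
open Literature.Probability.LatticeModels Literature.Probability.RandomPlanarGeometry
  Literature.Probability.RandomPlanarGeometry.SAW

namespace Summit.CriticalPhenomena.SAWScalingLimit.Theorems.HexTight.Reversal

variable {Λ : Finset HexVertex} {w w' : Sym2 HexVertex}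

/-- The arc `γ` uses only edges of the graph `H`: consecutive visited vertices are `H`-adjacent
(in applications `H = hexDomainGraph Ω δ`; inside a virgin disc `H` contains all of `hexGraph`). -/
def IsHArc (H : SimpleGraph HexVertex) (γ : HexMidEdgeSAW Λ w w') : Prop :=
  γ.verts.IsChain H.Adj

/-- The arc as a parametrised polyline `mid(w), c(v₁), …, c(vₙ), mid(w')` in lattice units
(`HexMidEdgeSAW.points`, `polyline`). -/
def arcCurve (γ : HexMidEdgeSAW Λ w w') : Curve ℂ := ⟨polyline γ.points⟩

/-- `Z^H_Λ(w → w')`: the `x_c`-mass `Σ x_c^{ℓ(γ)}` of the `H`-arcs of `Λ` from the mid-edge `w` to the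
mid-edge `w'` (a finite sum, `HexMidEdgeSAW.instFintype`). -/
def arcMass (H : SimpleGraph HexVertex) (Λ : Finset HexVertex) (w w' : Sym2 HexVertex) : ℝ :=
  ∑ γ : HexMidEdgeSAW Λ w w', if IsHArc H γ then hexCriticalFugacity ^ γ.length else 0

/-- The `x_c`-mass of the `H`-arcs `w → w'` of `Λ` that DIVE to radius `r` about `z₀`: some visited
vertex has its centre in the closed disc `B̄(z₀, r)`. -/
def diveMass (H : SimpleGraph HexVertex) (Λ : Finset HexVertex) (w w' : Sym2 HexVertex)
    (z₀ : ℂ) (r : ℝ) : ℝ :=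
  ∑ γ : HexMidEdgeSAW Λ w w',
    if IsHArc H γ ∧ ∃ v ∈ γ.verts, dist (hexCenter v) z₀ ≤ r then
      hexCriticalFugacity ^ γ.length else 0

/-- The `x_c`-mass of the `H`-arcs `w → w'` of `Λ` whose polyline traverses the shell `D(z₀; r, R)`
by `k` separate segments (`Curve.HasTraversals`, the Aizenman–Burchard event). -/
def travMass (H : SimpleGraph HexVertex) (Λ : Finset HexVertex) (w w' : Sym2 HexVertex)
    (k : ℕ) (z₀ : ℂ) (r R : ℝ) : ℝ :=
  ∑ γ : HexMidEdgeSAW Λ w w',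
    if IsHArc H γ ∧ (arcCurve γ).HasTraversals k z₀ r R then hexCriticalFugacity ^ γ.length else 0

/-- **`w` is a DOOR of `Λ` on the circle of radius `N` about `z₀`**: `w = {u, c}` is an edge of `ℍ`
with `c ∈ Λ` in the closed disc and `u ∉ Λ` strictly outside it (so the arc's first/last vertex is
`c`). -/
def Straddles (Λ : Finset HexVertex) (z₀ : ℂ) (N : ℝ) (w : Sym2 HexVertex) : Prop :=
  ∃ u c : HexVertex, w = s(u, c) ∧ hexGraph.Adj u c ∧ u ∉ Λ ∧ c ∈ Λ ∧
    dist (hexCenter c) z₀ ≤ N ∧ N < dist (hexCenter u) z₀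

/-- **VIRGIN DISC**: the open lattice disc of radius `N` about `z₀` lies in `Λ`, and `H` contains
every edge of `ℍ` between cells of the closed `(N+1)`-disc (one lattice unit of collar; the edge
length of `ℍ` is `1/√3`). Nothing is assumed outside the disc. -/
structure IsVirgin (H : SimpleGraph HexVertex) (Λ : Finset HexVertex) (z₀ : ℂ) (N : ℝ) :
    Prop where
  /-- every cell of the open `N`-disc is a vertex of the domain -/
  mem : ∀ v : HexVertex, dist (hexCenter v) z₀ < N → v ∈ Λ
  /-- every `ℍ`-edge between cells of the closed `(N+1)`-disc is an edge of `H` -/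
  adj : ∀ v v' : HexVertex, dist (hexCenter v) z₀ ≤ N + 1 → dist (hexCenter v') z₀ ≤ N + 1 →
    hexGraph.Adj v v' → H.Adj v v'

/-- Dive mass is at most arc mass (termwise: the dive event only removes terms of a sum of nonnegative
weights). Registered sub-goal `diveMass_le_arcMass` of the crux skeleton (used by the milestone
`bulkOneArmDecay_of`). -/
theorem diveMass_le_arcMass :
    ∀ (H : SimpleGraph HexVertex) (Λ : Finset HexVertex) (w w' : Sym2 HexVertex) (z₀ : ℂ) (r : ℝ),
      diveMass H Λ w w' z₀ r ≤ arcMass H Λ w w' := by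
  intro H Λ w w' z₀ r
  unfold diveMass arcMass
  refine Finset.sum_le_sum fun γ _ => ?_
  have hx : 0 ≤ hexCriticalFugacity ^ γ.length := pow_nonneg hexCriticalFugacity_pos_lt_one.1.le _
  by_cases hA : IsHArc H γ
  · by_cases hB : ∃ v ∈ γ.verts, dist (hexCenter v) z₀ ≤ r
    · rw [if_pos ⟨hA, hB⟩, if_pos hA]
    · rw [if_neg (fun h => hB h.2), if_pos hA]; exact hx
  · rw [if_neg (fun h => hA h.1), if_neg hA]

end Summit.CriticalPhenomena.SAWScalingLimit.Theorems.HexTight.Reversal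

end
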